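import Summits.QuantumFields.YangMills.Theorems.BalabanUVNodesN15BackgroundScalarByParts
import Summits.QuantumFields.YangMills.Theorems.BalabanUVNodesN15BackgroundLayerFirstOrderFull
import HarnessLib

/-!
# Route «BalabanUVNodes» (K4 «SpineRates»), node N15 = NE2, BACKGROUND LAYER — THE FIRST-ORDER LAYER WITH ENTRY 2 BY PARTS, part 1: the coefficient carrier WITH THE
# GRADIENT LETTERS, the realised instances, the four entry operators (entry 2 = the by-parts object on `ι_ν`), and ★★ ENTRY 2 UNDER THE GUARD — NO MIXED PIECE `∇G∇*`

Cell `pub-ymgap`, seat `pub-ymgap-dag-n15-c` (generation g8; R134 ACCELERATION SEAT, strategy s1; HUMAN RULING D-0062; chair R424 venue; `bears_on: R4∕N15`).  Filed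
`--kind proof --supports stmt-QuantumFields-20509 --as helper` (K3⁶; count-neutral).  Imports BY NAME this seat's `…N15BackgroundScalarByParts` (FILE 6; through it FILES 1–5:
`e2ByParts`, `bopOf`, `krowOf`, `E2Unit`, `hasMaj_idef_entry2_of_letters`, `hasMaj_injJ`, `sumJ`, `fgrad`, `fgradAdj`, the scalar letters) and n15-b's B4
`…N15BackgroundLayerFirstOrderFull` (`coeffBg₁`, `avg₁`, `bgPair`, `unstack`, `unstack_letters_of_reg335`, `hasMaj_entry01_background₁`, `bgConst`, `opGeo`, `fineGeo`, `opFamily`);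
nothing in the tree is modified.

WHY.  n15-b's B4 (`…FirstOrderFull`: `bgOps₁4`, `ne2PlusOperator_background₁4`) constructs all four (3.42) entries of the first-order background-dependent pair, entry 2 through
the LEFT Neumann source step `pr₀(1 − ĜV̂)⁻¹(Ĝ∇*)` whose letters include the MIXED pieces `∇_μG∇_ν*` (`hSD`, `hDSD`) — available for the single-scale vector piece, NOT for
Bałaban's full `U ≡ 1` propagator (log-divergent in sup-block currency; [B4-I] (1.112)–(1.113) p.36, [B9] (3.44) p.398 bound them only with a Hölder source norm).  THIS FILE
is B4 with ENTRY 2 REPLACED by the by-parts object of FILES 1–6 (right Neumann (3.64)–(3.65) + lattice integration by parts): `bgOpsBP`'s entry 2 is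
`𝔇(E₂′, E₂)∘ι_ν` with `E₂ = B̂(1+K̂)⁻¹` (`e2OpBP`), which IS `𝔇(pr₀X̂′∇′_ν*, pr₀X̂∇_ν*)` by FILE 6's identification; its letters are entries 0 and 2 of the `U ≡ 1` pair, the one-step
shifts, the coefficient letters of the new carrier `coeffBgBP` (n15-b's `coeffBg₁` letter pair PLUS the gradient letters of (3.35) and the translated ∕ derivative fits of (3.36) type,
as hypothesis shapes), and ONE shift-defect row letter (on the torus: FILE 4 ★★, hypothesis-free).  ★★ `hasMaj_entry2_byParts` bounds it under B4's guard.

CONTENTS ([folklore] bookkeeping; 7 defs).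
* §1 `coeffBgBP` (carrier), `reg335_coeffBg₁_of_BP`, `bgPairingBP`, `bgInstanceBP`, `bgInstanceBP_M`.
* §2 `e2OpBP`, `bgOpsBP`, `bgFamilyBP`, `idef_comp_injJ`.
* §3 `mKOf_mul`, `mBOf_mul`, `bpConst2` (+ `_nonneg`), ★★ **`hasMaj_entry2_byParts`** (`≤ bpConst2·θ·e^{−(δ−6σ)d}`).

HONEST FRAMING ∕ LIMITS.  MECHANISM + bookkeeping over hypothesis-shaped letters on abstract lattices; the carrier's (3.35)–(3.36) letters are DISPLAYED shapes (the second-difference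
content is folded into the fit clauses); nothing about Bałaban's `G(U)` asserted here.  NE2⁺ NOT PRINTED, NOT proved, not claimed; count-neutral (typed 28∕28 · discharged 5∕27 of
record unchanged); N15 NOT discharged; one finite lattice at fixed ε — NOT ℝ⁴, NOT infinite volume, NOT OS, NOT a mass gap, NOT Clay.
-/

noncomputable section

open scoped BigOperators
open Finset

namespace Summit.QuantumFields.YangMills.BalabanUVNodes.N15.BackgroundLayer

open Literature.MathematicalPhysics.QuantumFieldTheory.Balaban1983to89
open Literature.MathematicalPhysics.QuantumFieldTheory.Balaban1983to89.B11SectG (BlockNorm HasMaj RowSum hasMaj_comp hasMaj_comp_exp hasMaj_zero)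
open Literature.MathematicalPhysics.QuantumFieldTheory.Balaban1983to89.T4EtaRate (PairedInstance EtaPairing EtaRateIneq342 NE2PlusOperator rateFactor)
open Literature.MathematicalPhysics.QuantumFieldTheory.Balaban1983to89.T4EtaRateDefect (idef idef_apply idef_comp rateWeight)
open Literature.MathematicalPhysics.QuantumFieldTheory.Balaban1983to89.T4EtaRateCoeffDefect (pull pull_apply diagK diagK_nonneg FibreOsc blockAvg fit_blockAvg hasMaj_mulOp
  hasMaj_idef_mulOp)
open Literature.MathematicalPhysics.QuantumFieldTheory.Balaban1983to89.B6RandomWalk (Triangle254)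
open Literature.MathematicalPhysics.QuantumFieldTheory.Balaban1983to89.B6Prop26Gluing (mulOp mulOp_apply)
open Literature.MathematicalPhysics.QuantumFieldTheory.Balaban1983to89.B9SectDSup (inv_one_sub_le_two)
open Summit.QuantumFields.YangMills.BalabanUVNodes.N15.OperatorReadout (opGeo opFamily opGeo_len rateFactor_opGeo etaRateIneq342_of_hasMaj)
open Summit.QuantumFields.YangMills.BalabanUVNodes.N15.MatrixSpecies (liftMap liftBlk)
open Summit.QuantumFields.YangMills.BalabanUVNodes.N15.BackgroundModel (kappa_ofBlocks)
open Summit.QuantumFields.YangMills.BalabanUVNodes.N15.SiteLayer (hasMaj_exp_comp_diagK hasMaj_diagK_comp_exp hasMaj_add_exp hasMaj_exp_mono)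

variable {d : ℕ}

/-! ## §1 The first-order coefficient carrier WITH THE GRADIENT LETTERS, the pairing, the instances -/

section Carrier

variable {X X' : Type} (J : Type) [Fintype X'] [DecidableEq X]

/-- THE FIRST-ORDER SCALAR COEFFICIENT CARRIER WITH THE GRADIENT LETTERS (the by-parts device's reading of (3.35)–(3.36) at the unit scale): configurations `U = (c′, (a′_μ)_μ)`
(fine coefficients of `V′ = M_{c′} + Σ_μ M_{a′_μ}∇′_μ`), `one := 0`, `mul := (+)`; `Reg335 c α₀ U` = n15-b's `coeffBg₁` letter pair (sup `|c′|, |a′_μ| ≤ cMα₀`, within-block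
oscillations `≤ cMα₀θ`) AND, with `ā_μ = blockAvg π a′_μ` the coarse partner and `e_μ, e′_μ` the translations of the two lattices at reciprocal spacings `n, n′`: the GRADIENT letters
`|n(ā_μ(e_μx) − ā_μ(x))|, |n′(a′_μ(e′_μx′) − a′_μ(x′))| ≤ cMα₀`, the translated fit `|a′_μ(e′_μ⁻¹x′) − ā_μ(e_μ⁻¹πx′)| ≤ cMα₀θ`, the translated-DERIVATIVE fit
`|∇′_μa′_μ(e′_μ⁻¹x′) − ∇_μā_μ(e_μ⁻¹πx′)| ≤ cMα₀θ` and the coarse one-step oscillation `|ā_μ(x) − ā_μ(e_μ⁻¹x)| ≤ cMα₀θ` — HYPOTHESIS SHAPES (the second-difference content of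
(3.36) is folded into the last three); `Reg336` repeats it; (3.37)–(3.38) inert. [cite: Balaban1985BackgroundPropagators, (3.35)–(3.36) p.396 (shapes); (3.52) p.400 (first-order species: shape)] -/
def coeffBgBP (π : X' → X) (τ : J → X ≃ X) (τ' : J → X' ≃ X') (n n' M θ : ℝ) : B9.Backgrounds where
  Cfg := (X' → ℝ) × (J → X' → ℝ)
  one := 0
  mul := fun U₁ U₂ => U₁ + U₂
  Reg335 := fun c α₀ U =>
    (((∀ x', |U.1 x'| ≤ c * M * α₀) ∧ ∀ μ x', |U.2 μ x'| ≤ c * M * α₀) ∧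
      (FibreOsc π U.1 (fun _ => c * M * α₀ * θ) ∧ ∀ μ, FibreOsc π (U.2 μ) (fun _ => c * M * α₀ * θ))) ∧
    ((∀ μ x, |fgrad n (τ μ) (blockAvg π (U.2 μ)) x| ≤ c * M * α₀) ∧ (∀ μ x', |fgrad n' (τ' μ) (U.2 μ) x'| ≤ c * M * α₀) ∧
      (∀ μ x', |U.2 μ ((τ' μ).symm x') - blockAvg π (U.2 μ) ((τ μ).symm (π x'))| ≤ c * M * α₀ * θ) ∧
      (∀ μ x', |fgrad n' (τ' μ) (U.2 μ) ((τ' μ).symm x') - fgrad n (τ μ) (blockAvg π (U.2 μ)) ((τ μ).symm (π x'))| ≤ c * M * α₀ * θ) ∧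
      ∀ μ x, |blockAvg π (U.2 μ) x - blockAvg π (U.2 μ) ((τ μ).symm x)| ≤ c * M * α₀ * θ)
  Reg336 := fun c α₀ U =>
    (((∀ x', |U.1 x'| ≤ c * M * α₀) ∧ ∀ μ x', |U.2 μ x'| ≤ c * M * α₀) ∧
      (FibreOsc π U.1 (fun _ => c * M * α₀ * θ) ∧ ∀ μ, FibreOsc π (U.2 μ) (fun _ => c * M * α₀ * θ))) ∧
    ((∀ μ x, |fgrad n (τ μ) (blockAvg π (U.2 μ)) x| ≤ c * M * α₀) ∧ (∀ μ x', |fgrad n' (τ' μ) (U.2 μ) x'| ≤ c * M * α₀) ∧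
      (∀ μ x', |U.2 μ ((τ' μ).symm x') - blockAvg π (U.2 μ) ((τ μ).symm (π x'))| ≤ c * M * α₀ * θ) ∧
      (∀ μ x', |fgrad n' (τ' μ) (U.2 μ) ((τ' μ).symm x') - fgrad n (τ μ) (blockAvg π (U.2 μ)) ((τ μ).symm (π x'))| ≤ c * M * α₀ * θ) ∧
      ∀ μ x, |blockAvg π (U.2 μ) x - blockAvg π (U.2 μ) ((τ μ).symm x)| ≤ c * M * α₀ * θ)
  Cplx337 := fun _ _ _ => True
  Cplx338 := fun _ _ _ => True

/-- the carrier's (3.35) IMPLIES n15-b's `coeffBg₁` letter pair (so B4's entries 0∕1∕3 apply verbatim). [folklore] -/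
theorem reg335_coeffBg₁_of_BP {π : X' → X} {τ : J → X ≃ X} {τ' : J → X' ≃ X'} {n n' M θ c α₀ : ℝ} {U : (X' → ℝ) × (J → X' → ℝ)}
    (h : (coeffBgBP J π τ τ' n n' M θ).Reg335 c α₀ U) : (coeffBg₁ J π M θ).Reg335 c α₀ U := h.1

variable {g : B6.Geometry} [Fintype X]

/-- THE η-PAIRING over the by-parts carriers (NOT PRINTED data): scale shift `m`, identity on sites, pull-back of test functions, block-averaged coefficient families
(n15-b `avg₁`). [cite: King1986, p.664 (convention before Prop. 3.8)] -/
def bgPairingBP (blk : X → g.Site) (π : X' → X) (τ : J → X ≃ X) (τ' : J → X' ≃ X') (n n' : ℝ) (m : ℕ) (hL : g.L ≠ 0) (θc θ : ℝ) :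
    EtaPairing (opGeo g X blk) (fineGeo g X' (blk ∘ π) m) (coeffBgBP J (fun x : X => x) τ τ n n g.M θc) (coeffBgBP J π τ τ' n n' g.M θ) where
  n := m
  k_eq := rfl
  L_eq := rfl
  M_eq := rfl
  eta_eq := by
    show g.eta * (g.L ^ m)⁻¹ * g.L ^ m = g.eta
    rw [mul_assoc, inv_mul_cancel₀ (pow_ne_zero _ hL), mul_one]
  ι := fun y => y
  scale_ι := fun _ => rfl
  dist_ι := fun _ _ => rfl
  τ := fun lam => pull π lam
  suppIn_τ := fun _ _ h x' hx' => h (π x') hx'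
  supNorm_τ := fun lam => by
    show (⨆ x' : X', |lam (π x')|) ≤ ⨆ x : X, |lam x|
    exact Real.iSup_le (fun x' => abs_le_iSup_abs lam (π x')) (Real.iSup_nonneg fun x => abs_nonneg _)
  avg := avg₁ J π
  avg_one := avg₁_zero J π

/-- THE REALISED PAIRED INSTANCE of the by-parts first-order background layer. [cite: Balaban1985BackgroundPropagators, Thm 3.14 pp.426–427 (typing template)] -/
def bgInstanceBP (blk : X → g.Site) (π : X' → X) (τ : J → X ≃ X) (τ' : J → X' ≃ X') (n n' : ℝ) (m : ℕ) (hL : g.L ≠ 0) (θc θ : ℝ) : PairedInstance :=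
  ⟨opGeo g X blk, fineGeo g X' (blk ∘ π) m, coeffBgBP J (fun x : X => x) τ τ n n g.M θc, coeffBgBP J π τ τ' n n' g.M θ, bgPairingBP J blk π τ τ' n n' m hL θc θ⟩

/-- THE GUARD IS LIVE: the fine geometry's size parameter is the datum's `M`. [folklore] -/
theorem bgInstanceBP_M (blk : X → g.Site) (π : X' → X) (τ : J → X ≃ X) (τ' : J → X' ≃ X') (n n' : ℝ) (m : ℕ) (hL : g.L ≠ 0) (θc θ : ℝ) :
    (bgInstanceBP J blk π τ τ' n n' m hL θc θ).gf.M = g.M := rfl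

end Carrier

/-! ## §2 The four entry operators — entry 2 BY PARTS — and the kernel family -/

section Ops

variable {X X' J : Type} [Fintype X] [Fintype X'] [Fintype J] [DecidableEq X] [DecidableEq X'] [DecidableEq J] {g : B6.Geometry}
  (blk : X → g.Site) (π : X' → X)

/-- THE BY-PARTS DRESSED ENTRY-2 OBJECT of the scalar species at ONE spacing: `E₂ = B̂(1 + K̂)⁻¹` on the tuple carrier with `S_ν = G∇_ν*` (`∇_ν* = fgradAdj n (τ ν)`),
`E₀ = pr₀(bgPair G D c a)`, multiplier `M_{c − Σ_μ(∇_μa_μ)∘e_μ⁻¹}`, rows `S_μM_{a_μ∘e_μ⁻¹}` — which IS `E₀∘∇_ν*` on `ι_ν` (FILE 6 `e0_comp_fgradAdj_eq_e2ByParts_scalar`).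
[cite: Balaban1985BackgroundPropagators, (3.42) p.397 (entry «G(U)∇*»: shape) + (3.64)–(3.65) p.402 (mechanism)] -/
def e2OpBP (τ : J → X ≃ X) (n : ℝ) (G : (X → ℝ) →ₗ[ℝ] (X → ℝ)) (D : J → (X → ℝ) →ₗ[ℝ] (X → ℝ)) (c : X → ℝ) (a : J → X → ℝ) :
    (X × J → ℝ) →ₗ[ℝ] (X → ℝ) :=
  e2ByParts (bopOf (fun ν => G ∘ₗ fgradAdj n (τ ν)) (projO none ∘ₗ bgPair G D c a) (mulOp (c - ∑ μ, fgrad n (τ μ) (a μ) ∘ ⇑(τ μ).symm)))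
    (krowOf (fun ν => G ∘ₗ fgradAdj n (τ ν)) (fun μ => pull ⇑(τ μ)) (fun μ => mulOp (a μ ∘ ⇑(τ μ).symm)) (fun _ => 0))

/-- THE FOUR ENTRY OPERATORS OF THE BY-PARTS FIRST-ORDER PAIR at a coefficient family `U` (coarse partner = block averages): entries 0∕1 = the `none` ∕ `some ν` components of
n15-b's `bgPair` (as `bgOps₁4`), ENTRY 2 = THE η-DEFECT OF THE BY-PARTS OBJECTS READ ON `ι_ν` (= `𝔇(E₀′∇′_ν*, E₀∇_ν*)` by the identification), entry 3 = the derived object of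
`D₃` (as `bgOps₁4`). [cite: Balaban1985BackgroundPropagators, (3.42) p.397 (the four entries: shape)] -/
def bgOpsBP (τ : J → X ≃ X) (τ' : J → X' ≃ X') (n n' : ℝ) (ν : J) (G D₃ : (X → ℝ) →ₗ[ℝ] (X → ℝ)) (D : J → (X → ℝ) →ₗ[ℝ] (X → ℝ))
    (G' D₃' : (X' → ℝ) →ₗ[ℝ] (X' → ℝ)) (D' : J → (X' → ℝ) →ₗ[ℝ] (X' → ℝ)) : Fin 4 → (X' → ℝ) × (J → X' → ℝ) → ((X → ℝ) →ₗ[ℝ] (X' → ℝ)) :=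
  fun k U => ![idef (pull π) (pull π) (projO none ∘ₗ bgPair G' D' U.1 U.2) (projO none ∘ₗ bgPair G D (avg₁ J π U).1 (avg₁ J π U).2),
    idef (pull π) (pull π) (projO (some ν) ∘ₗ bgPair G' D' U.1 U.2) (projO (some ν) ∘ₗ bgPair G D (avg₁ J π U).1 (avg₁ J π U).2),
    idef (pull (liftMap π J)) (pull π) (e2OpBP τ' n' G' D' U.1 U.2) (e2OpBP τ n G D (avg₁ J π U).1 (avg₁ J π U).2) ∘ₗ injJ ν,
    idef (pull π) (pull π) (bgDerivedV (stack G' D') D₃' (unstack U.1 U.2)) (bgDerivedV (stack G D) D₃ (unstack (avg₁ J π U).1 (avg₁ J π U).2))] k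

/-- THE KERNEL FAMILY over the by-parts carrier. [cite: Balaban1985BackgroundPropagators, (3.42) p.397 (shape)] -/
def bgFamilyBP (τ : J → X ≃ X) (τ' : J → X' ≃ X') (n n' : ℝ) (m : ℕ) (hL : g.L ≠ 0) (θc θ : ℝ) (ν : J) (G D₃ : (X → ℝ) →ₗ[ℝ] (X → ℝ))
    (D : J → (X → ℝ) →ₗ[ℝ] (X → ℝ)) (G' D₃' : (X' → ℝ) →ₗ[ℝ] (X' → ℝ)) (D' : J → (X' → ℝ) →ₗ[ℝ] (X' → ℝ)) :
    B9.KernelFamily (bgInstanceBP J blk π τ τ' n n' m hL θc θ).gc (bgInstanceBP J blk π τ τ' n n' m hL θc θ).Bf :=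
  show B9.KernelFamily (opGeo g X blk) (coeffBgBP J π τ τ' n n' g.M θ) from
    opFamily (g := g) (B := coeffBgBP J π τ τ' n n' g.M θ) blk (blk ∘ π) (bgOpsBP π τ τ' n n' ν G D₃ D G' D₃' D')

omit [Fintype X] [Fintype X'] [Fintype J] [DecidableEq X] [DecidableEq X'] in
/-- the entry-2 defect on `ι_ν` IS `𝔇(E₂′∘ι′_ν, E₂∘ι_ν)` (the injection commutes with the tuple transport). [folklore] -/
theorem idef_comp_injJ {T' : (X' × J → ℝ) →ₗ[ℝ] (X' → ℝ)} {T : (X × J → ℝ) →ₗ[ℝ] (X → ℝ)} (ν : J) :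
    idef (pull (liftMap π J)) (pull π) T' T ∘ₗ injJ ν = idef (pull π) (pull π) (T' ∘ₗ injJ ν) (T ∘ₗ injJ ν) :=
  LinearMap.ext fun _ => rfl

end Ops

/-! ## §3 The constants, and ENTRY 2 BY PARTS under the guard -/

section Entry2

variable {X X' J : Type} [Fintype X] [Fintype X'] [Fintype J] [DecidableEq X] [DecidableEq X'] [DecidableEq J] {g : B6.Geometry}
  (blk : X → g.Site) (π : X' → X)

/-- `mKOf` is linear in its three rate-small slots. [folklore] -/
theorem mKOf_mul (nJ βS cT a₀ mS o mT cr t : ℝ) : mKOf nJ βS cT a₀ (t * mS) (t * o) (t * mT) cr = t * mKOf nJ βS cT a₀ mS o mT cr := by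
  unfold mKOf; ring

/-- `mBOf` is linear in its three rate-small slots. [folklore] -/
theorem mBOf_mul (nJ βS β₀ r cr mS m₀ o t : ℝ) : mBOf nJ βS β₀ r cr (t * mS) (t * m₀) (t * o) = t * mBOf nJ βS β₀ r cr mS m₀ o := by
  unfold mBOf; ring

/-- THE ENTRY-2 CONSTANT of the by-parts first-order layer (U-independent: letters weakened to the guard `a₀`). [folklore] -/
def bpConst2 (nJ β cr m₀ c35 a₀ cT mT : ℝ) : ℝ :=
  srcConst nJ β (β * 2) (c35 * a₀ * (1 + nJ)) cr * (1 * (1 - 1 * rowConst nJ β cT (c35 * a₀) cr * cr * cr))⁻¹ *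
      mKOf nJ β cT (c35 * a₀) m₀ (c35 * a₀ * (1 + nJ)) mT cr * cr * (1 * (1 - 1 * rowConst nJ β cT (c35 * a₀) cr * cr * cr))⁻¹ * cr * cr +
    mBOf nJ β (β * 2) (c35 * a₀ * (1 + nJ)) cr m₀ (bgConst β cr m₀ (c35 * (1 + nJ)) a₀) (c35 * a₀ * (1 + nJ)) *
      (1 * (1 - 1 * rowConst nJ β cT (c35 * a₀) cr * cr * cr))⁻¹ * cr

/-- `0 ≤ bpConst2` under the smallness. [folklore] -/
theorem bpConst2_nonneg {nJ β cr m₀ c35 a₀ cT mT : ℝ} (hnJ : 0 ≤ nJ) (hβ : 0 ≤ β) (hcr : 0 ≤ cr) (hm₀ : 0 ≤ m₀) (hc35 : 0 ≤ c35) (ha₀ : 0 ≤ a₀) (hcT : 0 ≤ cT)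
    (hmT : 0 ≤ mT) (hq : 1 * rowConst nJ β cT (c35 * a₀) cr * cr * cr < 1) : 0 ≤ bpConst2 nJ β cr m₀ c35 a₀ cT mT := by
  have hA : 0 ≤ (1 * (1 - 1 * rowConst nJ β cT (c35 * a₀) cr * cr * cr))⁻¹ := by
    rw [one_mul]; exact inv_nonneg.2 (by linarith)
  have h1 : 0 ≤ bgConst β cr m₀ (c35 * (1 + nJ)) a₀ := bgConst_nonneg hβ hcr hm₀ (by positivity) ha₀
  unfold bpConst2
  set A := (1 * (1 - 1 * rowConst nJ β cT (c35 * a₀) cr * cr * cr))⁻¹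
  set B := bgConst β cr m₀ (c35 * (1 + nJ)) a₀
  unfold srcConst mKOf mBOf
  positivity

variable {τ : J → X ≃ X} {τ' : J → X' ≃ X'} {n n' : ℝ} {G : (X → ℝ) →ₗ[ℝ] (X → ℝ)} {D : J → (X → ℝ) →ₗ[ℝ] (X → ℝ)} {G' : (X' → ℝ) →ₗ[ℝ] (X' → ℝ)}
  {D' : J → (X' → ℝ) →ₗ[ℝ] (X' → ℝ)}
set_option maxHeartbeats 400000 in
/-- ★★ **ENTRY 2 OF THE FIRST-ORDER PAIR, BY PARTS, UNDER THE GUARD** — NO MIXED PIECE.  Data: a [B6] carrier ((2.54), `d ≥ 0`, `d(y,y) = 0`, (2.61) at `σ ≥ 0`, `6σ ≤ δ`);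
lattices `X, X′` paired by `π`, translations `τ, τ′` at reciprocal spacings `n, n′`; the `U ≡ 1` LAYER at rate `δ`: pieces `G, G′`, derived pieces `D_μ, D′_μ` `≤ βe^{−δd}` with
defects `m₀θe^{−δd}`, the `U ≡ 1` ENTRY-2 operators `G∇_ν*, G′∇′_ν*` `≤ βe^{−δd}` with defects `𝔇(G′∇′_ν*, G∇_ν*) ≤ m₀θe^{−δd}`, the one-step shifts `≤ c_Te^{−δd}`; a
`Reg335`-regular coefficient family `U` of `coeffBgBP` under B4's guard (`c₃₅ > 0`, `β(c₃₅(1+|J|)a₀)c_r ≤ ½`, `M ≥ 1`, `Mα₀ ≤ a₀`) and the by-parts smallness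
`rowConst(|J|, β, c_T, c₃₅a₀, c_r)·c_r² ≤ ½`; and THE SHIFT-DEFECT ROW LETTER at `U` (`≤ m_Tθe^{−δd}`).  CONCLUSION: the entry-2 operator of `bgOpsBP` at `U` obeys
`≤ bpConst2(|J|, β, c_r, m₀, c₃₅, a₀, c_T, m_T)·θ·e^{−(δ−6σ)d}`.  Assembled from FILE 3 ★★ with: `E₀′` = n15-b B1a Neumann bound, `𝔇(E₀′,E₀)` = B4 `hasMaj_entry01_background₁`,
multiplier ∕ coefficient letters = FILE 6 on the carrier's letters. [cite: Balaban1985BackgroundPropagators, Thm 3.1 (3.42) p.397 (entry «G(U)∇*»: shape) + (3.64)–(3.65) p.402 (mechanism)] -/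
theorem hasMaj_entry2_byParts (htri : Triangle254 g) (hd : ∀ a b : g.Site, 0 ≤ g.dist a b) (hd0 : ∀ y : g.Site, g.dist y y = 0) {σ cr : ℝ} (hσ : 0 ≤ σ)
    (hcr : 0 ≤ cr) (hrow : RowSum g σ cr) {δ β m₀ θ c35 a₀ M α₀ cT mT : ℝ} (hσδ : 6 * σ ≤ δ) (hβ : 0 ≤ β) (hm₀ : 0 ≤ m₀) (hθ : 0 ≤ θ) (hc35 : 0 < c35)
    (ha₀ : 0 ≤ a₀) (hq : β * (c35 * (1 + Fintype.card J) * a₀) * cr ≤ 1 / 2) (hM : 1 ≤ M) (hα₀ : 0 < α₀) (hMα : M * α₀ ≤ a₀) (hcT : 0 ≤ cT) (hmT : 0 ≤ mT)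
    (hq2 : 1 * rowConst (Fintype.card J) β cT (c35 * a₀) cr * cr * cr ≤ 1 / 2)
    (hG : HasMaj (BlockNorm.ofBlocks g blk) (BlockNorm.ofBlocks g blk) G (fun y y' => β * Real.exp (-(δ * g.dist y y'))))
    (hD : ∀ μ, HasMaj (BlockNorm.ofBlocks g blk) (BlockNorm.ofBlocks g blk) (D μ) (fun y y' => β * Real.exp (-(δ * g.dist y y'))))
    (hG' : HasMaj (BlockNorm.ofBlocks g (blk ∘ π)) (BlockNorm.ofBlocks g (blk ∘ π)) G' (fun y y' => β * Real.exp (-(δ * g.dist y y'))))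
    (hD' : ∀ μ, HasMaj (BlockNorm.ofBlocks g (blk ∘ π)) (BlockNorm.ofBlocks g (blk ∘ π)) (D' μ) (fun y y' => β * Real.exp (-(δ * g.dist y y'))))
    (hDG : HasMaj (BlockNorm.ofBlocks g blk) (BlockNorm.ofBlocks g (blk ∘ π)) (idef (pull π) (pull π) G' G)
      (fun y y' => m₀ * θ * Real.exp (-(δ * g.dist y y'))))
    (hDD : ∀ μ, HasMaj (BlockNorm.ofBlocks g blk) (BlockNorm.ofBlocks g (blk ∘ π)) (idef (pull π) (pull π) (D' μ) (D μ))
      (fun y y' => m₀ * θ * Real.exp (-(δ * g.dist y y'))))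
    (hS : ∀ ν, HasMaj (BlockNorm.ofBlocks g blk) (BlockNorm.ofBlocks g blk) (G ∘ₗ fgradAdj n (τ ν)) (fun y y' => β * Real.exp (-(δ * g.dist y y'))))
    (hS' : ∀ ν, HasMaj (BlockNorm.ofBlocks g (blk ∘ π)) (BlockNorm.ofBlocks g (blk ∘ π)) (G' ∘ₗ fgradAdj n' (τ' ν)) (fun y y' => β * Real.exp (-(δ * g.dist y y'))))
    (hDS : ∀ ν, HasMaj (BlockNorm.ofBlocks g blk) (BlockNorm.ofBlocks g (blk ∘ π)) (idef (pull π) (pull π) (G' ∘ₗ fgradAdj n' (τ' ν)) (G ∘ₗ fgradAdj n (τ ν)))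
      (fun y y' => m₀ * θ * Real.exp (-(δ * g.dist y y'))))
    (hSh : ∀ μ, HasMaj (BlockNorm.ofBlocks g blk) (BlockNorm.ofBlocks g blk) (pull ⇑(τ μ)) (fun y y' => cT * Real.exp (-(δ * g.dist y y'))))
    (hSh' : ∀ μ, HasMaj (BlockNorm.ofBlocks g (blk ∘ π)) (BlockNorm.ofBlocks g (blk ∘ π)) (pull ⇑(τ' μ)) (fun y y' => cT * Real.exp (-(δ * g.dist y y'))))
    {U : (X' → ℝ) × (J → X' → ℝ)} (hreg : (coeffBgBP J π τ τ' n n' M θ).Reg335 c35 α₀ U)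
    (hDSh : ∀ μ, HasMaj (BlockNorm.ofBlocks g (liftBlk blk J)) (BlockNorm.ofBlocks g (blk ∘ π))
      (idef (pull π) (pull π) (pull ⇑(τ' μ)) (pull ⇑(τ μ)) ∘ₗ
        (mulOp ((avg₁ J π U).2 μ ∘ ⇑(τ μ).symm) ∘ₗ sumJ fun ν => G ∘ₗ fgradAdj n (τ ν))) (fun y y' => mT * θ * Real.exp (-(δ * g.dist y y'))))
    (ν : J) :
    HasMaj (BlockNorm.ofBlocks g blk) (BlockNorm.ofBlocks g (blk ∘ π))
      (idef (pull (liftMap π J)) (pull π) (e2OpBP τ' n' G' D' U.1 U.2) (e2OpBP τ n G D (avg₁ J π U).1 (avg₁ J π U).2) ∘ₗ injJ ν)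
      (fun y y' => bpConst2 (Fintype.card J) β cr m₀ c35 a₀ cT mT * θ * Real.exp (-((δ - 6 * σ) * g.dist y y'))) := by
  have hreg₁ : (coeffBg₁ J π M θ).Reg335 c35 α₀ U := reg335_coeffBg₁_of_BP J hreg
  obtain ⟨⟨⟨hsc, hsa⟩, hoc, hoa⟩, hga, hga', hfaT, hfgT, hosc⟩ := hreg
  obtain ⟨hR0, hRa, hq1, hinv, hV, hV', -⟩ := unstack_letters_of_reg335 (g := g) blk π hcr hβ hθ hc35 hq hM hMα hα₀ hreg₁
  -- the scalar letters under the guard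
  set r : ℝ := c35 * M * α₀ with hr_def
  have hnJ : (0 : ℝ) ≤ Fintype.card J := Nat.cast_nonneg _
  have hJ0 : (0 : ℝ) ≤ 1 + Fintype.card J := by positivity
  have hM0 : 0 ≤ M := zero_le_one.trans hM
  have hr0 : 0 ≤ r := by positivity
  have hra : r ≤ c35 * a₀ := by rw [hr_def, mul_assoc]; exact mul_le_mul_of_nonneg_left hMα hc35.le
  have hca0 : 0 ≤ c35 * a₀ := mul_nonneg hc35.le ha₀
  have hσδ' : σ ≤ δ := by linarith
  -- coarse coefficients and fits
  have hc : ∀ x, |(avg₁ J π U).1 x| ≤ r := abs_blockAvg_le π hr0 hsc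
  have ha : ∀ μ x, |(avg₁ J π U).2 μ x| ≤ r := fun μ => abs_blockAvg_le π hr0 (hsa μ)
  have hfc : ∀ x', |U.1 x' - (avg₁ J π U).1 (π x')| ≤ r * θ := fun x' => fit_blockAvg π hoc x'
  -- (E₀′): the fine dressed propagator's majorant `≤ 2β·e^{−(δ−σ)d}`
  have hSG' := hasMaj_stack (blk ∘ π) (fun _ _ => mul_nonneg hβ (Real.exp_nonneg _)) hG' hD'
  have hX' := hasMaj_bgPropV (blk ∘ π) (blkPair (blk ∘ π)) htri hd hrow hσ (ρ := δ - σ) (by linarith) (by linarith) hβ hR0 hSG' hV' hq1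
  have hE' : HasMaj (BlockNorm.ofBlocks g (blk ∘ π)) (BlockNorm.ofBlocks g (blk ∘ π)) (projO none ∘ₗ bgPair G' D' U.1 U.2)
      (fun y y' => β * 2 * Real.exp (-((δ - σ) * g.dist y y'))) :=
    (hasMaj_projO_comp (blk ∘ π) hX' none).mono fun y y' =>
      mul_le_mul_of_nonneg_right (mul_le_mul_of_nonneg_left hinv hβ) (Real.exp_nonneg _)
  -- (𝔇E₀): B4's entry 0
  have hDE := hasMaj_entry01_background₁ blk π htri hd hσ hcr hrow hσδ' hβ hm₀ hθ hc35 hq hM hα₀ hMα hG hD hG' hD' hDG hDD hreg₁ none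
  -- multiplier letters (FILE 6), weakened to the guard
  have hdiag : ∀ {t t' : ℝ}, t ≤ t' → ∀ y y' : g.Site, diagK (fun _ => t) y y' ≤ diagK (fun _ => t') y y' :=
    fun h y y' => T4EtaRateCoeffDefect.diagK_mono (fun _ => h) y y'
  have hrR : r + Fintype.card J * r ≤ c35 * a₀ * (1 + Fintype.card J) := by nlinarith
  have hR : HasMaj (BlockNorm.ofBlocks g blk) (BlockNorm.ofBlocks g blk)
      (mulOp ((avg₁ J π U).1 - ∑ μ, fgrad n (τ μ) ((avg₁ J π U).2 μ) ∘ ⇑(τ μ).symm)) (diagK fun _ => c35 * a₀ * (1 + Fintype.card J)) :=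
    (hasMaj_byPartsMult_scalar blk hr0 hr0 hc hga).mono (hdiag hrR)
  have hR' : HasMaj (BlockNorm.ofBlocks g (blk ∘ π)) (BlockNorm.ofBlocks g (blk ∘ π))
      (mulOp (U.1 - ∑ μ, fgrad n' (τ' μ) (U.2 μ) ∘ ⇑(τ' μ).symm)) (diagK fun _ => c35 * a₀ * (1 + Fintype.card J)) :=
    (hasMaj_byPartsMult_scalar (blk ∘ π) hr0 hr0 hsc hga').mono (hdiag hrR)
  have hoR : r * θ + Fintype.card J * (r * θ) ≤ c35 * a₀ * (1 + Fintype.card J) * θ := by nlinarith [mul_le_mul_of_nonneg_right hra hθ]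
  have hDR : HasMaj (BlockNorm.ofBlocks g blk) (BlockNorm.ofBlocks g (blk ∘ π))
      (idef (pull π) (pull π) (mulOp (U.1 - ∑ μ, fgrad n' (τ' μ) (U.2 μ) ∘ ⇑(τ' μ).symm))
        (mulOp ((avg₁ J π U).1 - ∑ μ, fgrad n (τ μ) ((avg₁ J π U).2 μ) ∘ ⇑(τ μ).symm))) (diagK fun _ => c35 * a₀ * (1 + Fintype.card J) * θ) :=
    (hasMaj_idef_byPartsMult_scalar blk π (mul_nonneg hr0 hθ) hfc hfgT).mono (hdiag hoR)
  -- coefficient letters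
  have haw : c35 * a₀ ≤ c35 * a₀ := le_rfl
  have hCa : ∀ μ, HasMaj (BlockNorm.ofBlocks g blk) (BlockNorm.ofBlocks g blk) (mulOp ((avg₁ J π U).2 μ ∘ ⇑(τ μ).symm)) (diagK fun _ => c35 * a₀) := fun μ =>
    (hasMaj_mulOp_translate blk hr0 ha μ).mono (hdiag hra)
  have hCa' : ∀ μ, HasMaj (BlockNorm.ofBlocks g (blk ∘ π)) (BlockNorm.ofBlocks g (blk ∘ π)) (mulOp (U.2 μ ∘ ⇑(τ' μ).symm)) (diagK fun _ => c35 * a₀) :=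
    fun μ => (hasMaj_mulOp_translate (blk ∘ π) hr0 hsa μ).mono (hdiag hra)
  have hoa0 : r * θ ≤ c35 * a₀ * (1 + Fintype.card J) * θ := by nlinarith [mul_le_mul_of_nonneg_right hra hθ, mul_nonneg (mul_nonneg hca0 hnJ) hθ]
  have hDCa : ∀ μ, HasMaj (BlockNorm.ofBlocks g blk) (BlockNorm.ofBlocks g (blk ∘ π))
      (idef (pull π) (pull π) (mulOp (U.2 μ ∘ ⇑(τ' μ).symm)) (mulOp ((avg₁ J π U).2 μ ∘ ⇑(τ μ).symm))) (diagK fun _ => c35 * a₀ * (1 + Fintype.card J) * θ) :=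
    fun μ => (hasMaj_idef_mulOp_translate blk π μ (mul_nonneg hr0 hθ) (hfaT μ)).mono (hdiag hoa0)
  have hCb : ∀ _μ : J, HasMaj (BlockNorm.ofBlocks g blk) (BlockNorm.ofBlocks g blk) (0 : (X → ℝ) →ₗ[ℝ] (X → ℝ)) (diagK fun _ => c35 * a₀) :=
    fun _ => hasMaj_zero_diagK blk blk hca0
  have hCb' : ∀ _μ : J, HasMaj (BlockNorm.ofBlocks g (blk ∘ π)) (BlockNorm.ofBlocks g (blk ∘ π)) (0 : (X' → ℝ) →ₗ[ℝ] (X' → ℝ)) (diagK fun _ => c35 * a₀) :=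
    fun _ => hasMaj_zero_diagK (blk ∘ π) (blk ∘ π) hca0
  have hDCb : ∀ _μ : J, HasMaj (BlockNorm.ofBlocks g blk) (BlockNorm.ofBlocks g (blk ∘ π))
      (idef (pull π) (pull π) (0 : (X' → ℝ) →ₗ[ℝ] (X' → ℝ)) (0 : (X → ℝ) →ₗ[ℝ] (X → ℝ))) (diagK fun _ => c35 * a₀ * (1 + Fintype.card J) * θ) :=
    fun _ => hasMaj_idef_zero_diagK blk π (by positivity)
  -- rate-lowered `U ≡ 1` letters at `δ − σ`
  have hS1 : ∀ ν, HasMaj (BlockNorm.ofBlocks g blk) (BlockNorm.ofBlocks g blk) (G ∘ₗ fgradAdj n (τ ν)) (fun y y' => β * Real.exp (-((δ - σ) * g.dist y y'))) :=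
    fun ν => hasMaj_exp_mono hd hβ (by linarith) (hS ν)
  have hS1' : ∀ ν, HasMaj (BlockNorm.ofBlocks g (blk ∘ π)) (BlockNorm.ofBlocks g (blk ∘ π)) (G' ∘ₗ fgradAdj n' (τ' ν))
      (fun y y' => β * Real.exp (-((δ - σ) * g.dist y y'))) := fun ν => hasMaj_exp_mono hd hβ (by linarith) (hS' ν)
  have hDS1 : ∀ ν, HasMaj (BlockNorm.ofBlocks g blk) (BlockNorm.ofBlocks g (blk ∘ π)) (idef (pull π) (pull π) (G' ∘ₗ fgradAdj n' (τ' ν)) (G ∘ₗ fgradAdj n (τ ν)))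
      (fun y y' => m₀ * θ * Real.exp (-((δ - σ) * g.dist y y'))) := fun ν => hasMaj_exp_mono hd (mul_nonneg hm₀ hθ) (by linarith) (hDS ν)
  have hSh1 : ∀ μ, HasMaj (BlockNorm.ofBlocks g blk) (BlockNorm.ofBlocks g blk) (pull ⇑(τ μ)) (fun y y' => cT * Real.exp (-((δ - σ) * g.dist y y'))) :=
    fun μ => hasMaj_exp_mono hd hcT (by linarith) (hSh μ)
  have hSh1' : ∀ μ, HasMaj (BlockNorm.ofBlocks g (blk ∘ π)) (BlockNorm.ofBlocks g (blk ∘ π)) (pull ⇑(τ' μ)) (fun y y' => cT * Real.exp (-((δ - σ) * g.dist y y'))) :=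
    fun μ => hasMaj_exp_mono hd hcT (by linarith) (hSh' μ)
  have hDSh1 : ∀ μ, HasMaj (BlockNorm.ofBlocks g (liftBlk blk J)) (BlockNorm.ofBlocks g (blk ∘ π))
      (idef (pull π) (pull π) (pull ⇑(τ' μ)) (pull ⇑(τ μ)) ∘ₗ
        (mulOp ((avg₁ J π U).2 μ ∘ ⇑(τ μ).symm) ∘ₗ sumJ fun ν => G ∘ₗ fgradAdj n (τ ν))) (fun y y' => mT * θ * Real.exp (-((δ - σ) * g.dist y y'))) :=
    fun μ => hasMaj_exp_mono hd (mul_nonneg hmT hθ) (by linarith) (hDSh μ)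
  have hq2' : 1 * rowConst (Fintype.card J) β cT (c35 * a₀) cr * cr * cr < 1 := by linarith
  -- FILE 3 ★★ at rate `δ − σ`, final rate `δ − 6σ`
  have hC0 : 0 ≤ bgConst β cr m₀ (c35 * (1 + Fintype.card J)) a₀ := bgConst_nonneg hβ hcr hm₀ (by positivity) ha₀
  have key := hasMaj_idef_entry2_of_letters blk π htri hd hd0 hrow hσ hcr (δ := δ - σ) (ρ := δ - 6 * σ) (by linarith) (by linarith) hβ (by positivity)
    (by positivity) hcT hca0 (mul_nonneg hm₀ hθ) (mul_nonneg hC0 hθ) (by positivity) (mul_nonneg hmT hθ)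
    hS1 hS1' hE' hR hR' hSh1 hSh1' hCa hCa' hCb hCb' hDS1 hDE hDR hDCa hDCb hDSh1 hq2'
  -- the FILE-3 constant is `bpConst2 · θ`
  have hA : 0 ≤ (1 * (1 - 1 * rowConst (Fintype.card J) β cT (c35 * a₀) cr * cr * cr))⁻¹ := by rw [one_mul]; exact inv_nonneg.2 (by linarith)
  refine ((hasMaj_exp_comp_diagK (b₁ := BlockNorm.ofBlocks g blk) (b₃ := BlockNorm.ofBlocks g (blk ∘ π)) (liftBlk blk J) ?_ key (hasMaj_injJ blk ν))).mono ?_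
  · set A := (1 * (1 - 1 * rowConst (Fintype.card J) β cT (c35 * a₀) cr * cr * cr))⁻¹
    set B := bgConst β cr m₀ (c35 * (1 + (Fintype.card J : ℝ))) a₀
    unfold srcConst mKOf mBOf
    positivity
  · intro y y'
    refine le_of_eq ?_
    rw [bpConst2, show c35 * a₀ * (1 + (Fintype.card J : ℝ)) * θ = θ * (c35 * a₀ * (1 + Fintype.card J)) by ring, show m₀ * θ = θ * m₀ by ring,
      show mT * θ = θ * mT by ring, show bgConst β cr m₀ (c35 * (1 + (Fintype.card J : ℝ))) a₀ * θ = θ * bgConst β cr m₀ (c35 * (1 + Fintype.card J)) a₀ by ring,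
      mKOf_mul, mBOf_mul]
    ring

end Entry2

end Summit.QuantumFields.YangMills.BalabanUVNodes.N15.BackgroundLayer

end
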